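import Summits.ValiantsHypothesis.ValiantsHypothesis.Theorems.KPlusLogSqLawTropicalBToeplitzConjectureT

/-!
# Route `KPlusLogSqLaw`, crux `TropicalB` — Toeplitz sector: the MAJORIZATION RELAXATION of the displacement-profile polytope

HONEST FRAMING.  Helper toward the registered stubs `stub_tropThin` / `stub_tropFat` of
`Cruxes/TropicalB/Lines/birth.lean` (crux `Summit.ValiantsHypothesis.ValiantsHypothesis.Theses.KPlusLogSqLaw.TropicalB`,
ledger item `stmt-ValiantsHypothesis-19771`, route `KPlusLogSqLaw`; cell `pub-symmetroid`, seat `val-sym-trop-p3` (g4),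
2026-08-26).  A STRUCTURE LEMMA for the cell's Conjecture T (OPEN; `Toeplitz.LinearInstanceBound`, the plane-shadow count
of the displacement-profile polytope `Q_m = conv{N(σ) : σ ∈ S_m}`): every permutation's displacement vector is MAJORIZED by
the reversal's, i.e. for every set `S` of `k` positions

  `Σ_{b ∈ S} (σ b − b) ≤ k·(m − k)`                                   (`sum_displacement_le_card_mul`)

(the `k` largest displacements of the reversal `b ↦ m−1−b` are `m−1, m−3, …, m+1−2k`, summing to exactly `k(m−k)`), and
the equivalent TAIL form on thresholds `t`,

  `Σ_b (σ b − b − t)₊ ≤ Σ_{i < m} (m − 1 − 2i − t)₊`                   (`sum_posPart_displacement_le`),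

which is LINEAR in the profile `N(σ)` — so `Q_m` lies in the polytope cut out by `Σ_δ N_δ = m`, `Σ_δ δ·N_δ = 0` and these
`O(m)` tail inequalities (the histogram image of the permutahedron of `(m−1, m−3, …, 1−m)`).  This is the relaxation the
lane's regime method lacked beyond the single Lagrangian constraint `Σ_b δ_b = 0` (`…ToeplitzTwoPhase` / `…UnitRegime` /
`…Penalty`): e.g. no `k` positions can carry displacements summing to more than `k(m−k)`, whatever the instance.  Located
(this seat, hub, exact enumeration): the relaxation is EXACT (`=` the set of displacement multisets) for `m ≤ 5` and strict
from `m = 6` on (`{2,2,2,−2,−2,−2}` is majorized but is no profile — a parity obstruction).  Proof: the `k` images `σ(S)` are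
`k` distinct naturals `< m`, so their sum is at most `(m−1) + ⋯ + (m−k)`; the `k` positions are distinct naturals, so their sum
is at least `0 + ⋯ + (k−1)` (`two_mul_sum_le_of_lt`, `card_mul_le_two_mul_sum`, by `Finset.induction_on_max`).

Conjecture T stays OPEN; nothing here bears on `TropicalB` for general designs, `WeakLifting`, `KPlusLogSqLaw`,
`MatrixDescartes` or `VP ≠ VNP`.

References: folklore (majorization / the permutahedron; Hardy–Littlewood–Pólya rearrangement).
-/

set_option linter.dupNamespace false
set_option autoImplicit false

namespace Summit.ValiantsHypothesis.ValiantsHypothesis.Theorems.KPlusLogSqLaw.Toeplitz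

open scoped BigOperators
open Finset

/-! ## Sums of sets of distinct naturals -/

/-- A finite set of `k` naturals all `< n` has `2·Σ ≤ k·(2n − k − 1)`, i.e. `Σ ≤ (n−1) + ⋯ + (n−k)`. [folklore] -/
theorem two_mul_sum_le_of_lt (T : Finset ℕ) (n : ℕ) (hT : ∀ x ∈ T, x < n) :
    2 * (∑ x ∈ T, (x : ℤ)) ≤ (T.card : ℤ) * (2 * n - T.card - 1) := by
  induction T using Finset.induction_on_max generalizing n with
  | empty => simp
  | insert a s ha ih =>
    have han : a < n := hT a (mem_insert_self a s)
    have hs : ∀ x ∈ s, x < a := ha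
    have hnot : a ∉ s := fun h => lt_irrefl a (ha a h)
    have ih' := ih a hs
    rw [sum_insert hnot, card_insert_of_notMem hnot]
    push_cast
    have h1 : (a : ℤ) ≤ n - 1 := by
      have : (a : ℤ) < n := by exact_mod_cast han
      omega
    nlinarith [h1, ih', Int.natCast_nonneg s.card]

/-- A finite set of `k` naturals has `k·(k − 1) ≤ 2·Σ`, i.e. `Σ ≥ 0 + 1 + ⋯ + (k−1)`. [folklore] -/
theorem card_mul_le_two_mul_sum (T : Finset ℕ) :
    (T.card : ℤ) * (T.card - 1) ≤ 2 * (∑ x ∈ T, (x : ℤ)) := by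
  induction T using Finset.induction_on_max with
  | empty => simp
  | insert a s ha ih =>
    have hnot : a ∉ s := fun h => lt_irrefl a (ha a h)
    have hsub : s ⊆ range a := fun x hx => mem_range.mpr (ha x hx)
    have hcard : s.card ≤ a := by simpa using card_le_card hsub
    rw [sum_insert hnot, card_insert_of_notMem hnot]
    push_cast
    have : (s.card : ℤ) ≤ a := by exact_mod_cast hcard
    nlinarith [this, ih, Int.natCast_nonneg s.card]

/-! ## Majorization of displacement vectors by the reversal -/

section Majorization

variable {m : ℕ}

/-- **Majorization by the reversal.**  For every permutation `σ` of `Fin m` and every set `S` of positions,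
`Σ_{b ∈ S} (σ b − b) ≤ |S|·(m − |S|)` — the displacement vector of `σ` is majorized by `(m−1, m−3, …, 1−m)`, the
displacement vector of the reversal, whose `k` largest entries sum to `k(m−k)`. [folklore] -/
theorem sum_displacement_le_card_mul (σ : Equiv.Perm (Fin m)) (S : Finset (Fin m)) :
    ∑ b ∈ S, ((σ b : ℤ) - (b : ℤ)) ≤ (S.card : ℤ) * ((m : ℤ) - S.card) := by
  -- the images and the positions as sets of naturals
  set T₂ : Finset ℕ := (S.map σ.toEmbedding).map Fin.valEmbedding with hT₂
  set T₁ : Finset ℕ := S.map Fin.valEmbedding with hT₁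
  have hc₂ : T₂.card = S.card := by simp [hT₂]
  have hc₁ : T₁.card = S.card := by simp [hT₁]
  have hlt : ∀ x ∈ T₂, x < m := by
    intro x hx
    simp only [hT₂, mem_map, Fin.valEmbedding_apply, Equiv.toEmbedding_apply] at hx
    obtain ⟨a, ⟨b, _, rfl⟩, rfl⟩ := hx
    exact (σ b).isLt
  have hsum₂ : ∑ b ∈ S, (σ b : ℤ) = ∑ x ∈ T₂, (x : ℤ) := by
    rw [hT₂, sum_map, sum_map]
    rfl
  have hsum₁ : ∑ b ∈ S, (b : ℤ) = ∑ x ∈ T₁, (x : ℤ) := by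
    rw [hT₁, sum_map]
    rfl
  have hsum₂' : ∑ b ∈ S, (σ b : ℤ) = ∑ b ∈ S, ((σ b : ℕ) : ℤ) := rfl
  have h2 := two_mul_sum_le_of_lt T₂ m hlt
  have h1 := card_mul_le_two_mul_sum T₁
  rw [hc₂] at h2
  rw [hc₁] at h1
  rw [sum_sub_distrib, hsum₂, hsum₁]
  nlinarith [h1, h2]

/-- symmetric form: `Σ_{b ∈ S} (b − σ b) ≤ |S|·(m − |S|)` (apply the lemma to `σ⁻¹` and the set `σ(S)`). [folklore] -/
theorem sum_neg_displacement_le_card_mul (σ : Equiv.Perm (Fin m)) (S : Finset (Fin m)) :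
    ∑ b ∈ S, ((b : ℤ) - (σ b : ℤ)) ≤ (S.card : ℤ) * ((m : ℤ) - S.card) := by
  have h := sum_displacement_le_card_mul σ⁻¹ (S.map σ.toEmbedding)
  rw [card_map, sum_map] at h
  simp only [Equiv.toEmbedding_apply, Equiv.Perm.inv_def, Equiv.symm_apply_apply] at h
  exact h

/-- **Joint capacity of large displacements**: if `k` positions all carry displacement `≥ d` then `k·d ≤ k·(m − k)`
(so `k ≤ m − d` when `k ≥ 1`) — the joint form of the single-class capacity `N_δ ≤ m − |δ|` used by the regime method.
[folklore] -/
theorem card_mul_le_of_displacement_ge (σ : Equiv.Perm (Fin m)) (S : Finset (Fin m)) (d : ℤ)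
    (hS : ∀ b ∈ S, d ≤ (σ b : ℤ) - (b : ℤ)) :
    (S.card : ℤ) * d ≤ (S.card : ℤ) * ((m : ℤ) - S.card) := by
  calc (S.card : ℤ) * d = ∑ _b ∈ S, d := by rw [sum_const, nsmul_eq_mul]
    _ ≤ ∑ b ∈ S, ((σ b : ℤ) - (b : ℤ)) := sum_le_sum hS
    _ ≤ (S.card : ℤ) * ((m : ℤ) - S.card) := sum_displacement_le_card_mul σ S

/-- **Tail form (linear in the profile).**  For every threshold `t`:
`Σ_b (σ b − b − t)₊ ≤ Σ_{i < m} (m − 1 − 2i − t)₊` — the right-hand side is the same tail functional evaluated at the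
reversal `b ↦ m − 1 − b`.  As `(·)₊`-sums these are linear inequalities `Σ_δ (δ − t)₊·N_δ ≤ c_{m,t}` on displacement
profiles, valid on the whole polytope `Q_m`. [folklore] -/
theorem sum_posPart_displacement_le (σ : Equiv.Perm (Fin m)) (t : ℤ) :
    ∑ b : Fin m, max (((σ b : ℤ) - (b : ℤ)) - t) 0 ≤ ∑ i ∈ range m, max (((m : ℤ) - 1 - 2 * i) - t) 0 := by
  classical
  -- the positions above the threshold
  set S : Finset (Fin m) := univ.filter fun b => t < (σ b : ℤ) - (b : ℤ) with hS
  set k := S.card with hk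
  have hkm : k ≤ m := by
    rw [hk, hS]
    exact (card_filter_le _ _).trans (by simp)
  -- left side = Σ_{S} (δ − t)
  have hL : ∑ b : Fin m, max (((σ b : ℤ) - (b : ℤ)) - t) 0 = ∑ b ∈ S, (((σ b : ℤ) - (b : ℤ)) - t) := by
    rw [hS, sum_filter]
    refine sum_congr rfl fun b _ => ?_
    split_ifs with h
    · exact max_eq_left (by omega)
    · exact max_eq_right (by omega)
  have hL' : ∑ b ∈ S, (((σ b : ℤ) - (b : ℤ)) - t) ≤ (k : ℤ) * ((m : ℤ) - k) - k * t := by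
    rw [sum_sub_distrib, sum_const, nsmul_eq_mul, ← hk]
    linarith [sum_displacement_le_card_mul σ S]
  -- right side ≥ Σ_{i < k} (m − 1 − 2i − t) = k(m−1−t) − k(k−1) = k(m−k) − kt
  have hR : ∑ i ∈ range k, (((m : ℤ) - 1 - 2 * i) - t) ≤ ∑ i ∈ range m, max (((m : ℤ) - 1 - 2 * i) - t) 0 :=
    calc ∑ i ∈ range k, (((m : ℤ) - 1 - 2 * i) - t) ≤ ∑ i ∈ range k, max (((m : ℤ) - 1 - 2 * i) - t) 0 :=
          sum_le_sum fun i _ => le_max_left _ _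
      _ ≤ ∑ i ∈ range m, max (((m : ℤ) - 1 - 2 * i) - t) 0 :=
          sum_le_sum_of_subset_of_nonneg (range_subset_range.mpr hkm) fun i _ _ => le_max_right _ _
  have hR' : ∑ i ∈ range k, (((m : ℤ) - 1 - 2 * i) - t) = (k : ℤ) * ((m : ℤ) - k) - k * t := by
    have hid : (∑ i ∈ range k, (i : ℤ)) * 2 = (k : ℤ) * (k - 1) := by
      have h := sum_range_id_mul_two k
      have hcast : ((∑ i ∈ range k, i : ℕ) : ℤ) = ∑ i ∈ range k, (i : ℤ) := by push_cast; rfl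
      rcases Nat.eq_zero_or_pos k with hk0 | hkpos
      · simp [hk0]
      · have : ((k * (k - 1) : ℕ) : ℤ) = (k : ℤ) * (k - 1) := by
          rw [Nat.cast_mul, Nat.cast_sub hkpos]; simp
        rw [← hcast, ← this, ← h]; push_cast; ring
    rw [sum_sub_distrib, sum_sub_distrib, sum_const, card_range, nsmul_eq_mul, sum_const, card_range, nsmul_eq_mul]
    have : ∑ i ∈ range k, (2 : ℤ) * i = (∑ i ∈ range k, (i : ℤ)) * 2 := by rw [sum_mul]; exact sum_congr rfl fun i _ => by ring
    rw [this, hid]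
    ring
  rw [hL]
  linarith [hL', hR, hR']

/-- **The reversal attains every tail bound** (so the inequalities are sharp): for `ρ b = m − 1 − b`,
`Σ_{b < k} (ρ b − b) = k(m − k)`. [folklore] -/
theorem sum_displacement_rev_eq (k : ℕ) (hk : k ≤ m) :
    ∑ i ∈ range k, (((m : ℤ) - 1 - i) - i) = (k : ℤ) * ((m : ℤ) - k) := by
  have hid : (∑ i ∈ range k, (i : ℤ)) * 2 = (k : ℤ) * (k - 1) := by
    have h := sum_range_id_mul_two k
    have hcast : ((∑ i ∈ range k, i : ℕ) : ℤ) = ∑ i ∈ range k, (i : ℤ) := by push_cast; rfl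
    rcases Nat.eq_zero_or_pos k with hk0 | hkpos
    · simp [hk0]
    · have : ((k * (k - 1) : ℕ) : ℤ) = (k : ℤ) * (k - 1) := by
        rw [Nat.cast_mul, Nat.cast_sub hkpos]; simp
      rw [← hcast, ← this, ← h]; push_cast; ring
  have _ := hk
  have : ∑ i ∈ range k, (((m : ℤ) - 1 - i) - i) = ∑ i ∈ range k, (((m : ℤ) - 1) - 2 * i) :=
    sum_congr rfl fun i _ => by ring
  rw [this, sum_sub_distrib, sum_const, card_range, nsmul_eq_mul]
  have h2 : ∑ i ∈ range k, (2 : ℤ) * i = (∑ i ∈ range k, (i : ℤ)) * 2 := by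
    rw [sum_mul]; exact sum_congr rfl fun i _ => by ring
  rw [h2, hid]
  ring

end Majorization

/-! ## In the chain language: every member of every chain obeys the tail inequalities -/

/-- **Relaxation for Conjecture T** (restated where the lane uses it): along any family of permutations — in particular
the members `τ_k` of a `LinearInstanceBound` chain — each member's displacement vector is majorized by the reversal's:
for all `k` and all position sets `S`, `Σ_{b∈S} (τ_k b − b) ≤ |S|(m − |S|)`.  (Pure restatement of
`sum_displacement_le_card_mul`; recorded so that regime arguments can cite the joint capacity by name.) [folklore] -/
theorem chain_majorized {m N : ℕ} (τ : Fin (N + 1) → Equiv.Perm (Fin m)) (k : Fin (N + 1)) (S : Finset (Fin m)) :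
    ∑ b ∈ S, ((τ k b : ℤ) - (b : ℤ)) ≤ (S.card : ℤ) * ((m : ℤ) - S.card) :=
  sum_displacement_le_card_mul (τ k) S

end Summit.ValiantsHypothesis.ValiantsHypothesis.Theorems.KPlusLogSqLaw.Toeplitz
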